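import Summits.CriticalPhenomena.PercolationContinuityZ3.Theorems.PercNearOneGluingNoHeavyLowerTailSunflowerMultiPetalKempeMarkedConcave
import HarnessLib
import HarnessLib.Audit

/-!
# `NoHeavyLowerTail` (crux stmt-CriticalPhenomena-4575), marked multigraphs: ADDING AN EDGE IS THE MARK EFFECT ON THE CONTRACTION
# — the member–mark identity for the TWO-TERMINAL functional, `3·[T(K+pq) − T(K)] = T((K/qp)⁺ᵖ) − T(K/qp)`

Support file (seat `prim-l12-p2` gen 51; `--supports stmt-CriticalPhenomena-4575`; companion of `…KempeMarkedConcave` (p615089/p615883: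
`three_mul_QcolM_addEdge_sub`, the same identity for the Lemma-B functional `Q`)).  No `sorry`; nothing is asserted about the crux.
Memo: run/shared/lean/prim/prim-l12/prim-l12-p2/FINDING-g51-TI-HIERARCHY.md §1 ((MM_T)).

WHAT.  For a marked multigraph `K` on `V`, terminals `u, v`, and an edge `p–q` with `q ∉ {u, v}` (so that `q` may be contracted away; `p` may be a
terminal):
* `TfunM_contractOne_eq` : `T(K/qp; u, v) = 3·Σ_{σ u = 0, σ v = 1, σ p = σ q} fC (type_K σ)` — the two-terminal functional of the contraction of `q`
  into `p` (realised on `V` with `q` free, whence the factor `3`) is three times the part of the two-terminal sum of `K` on which `p` and `q` agree;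
* `TfunM_addMark_contractOne` : the same for the contraction marked once at `p`, against `Σ_{…, σ p = σ q} fC (type_{K⁺ᵖ} σ)`;
* `three_mul_TfunM_addEdge_sub` (**the identity (MM_T)**): `3·[T(K + pq) − T(K)] = T((K/qp)⁺ᵖ) − T(K/qp)`.
This is the first identity of the vertex-deletion calculus for `T` on general families (memo §1): read backwards it is the 'far pendant triple'
identity, and with `p = u` the 'pendant triple at a terminal' identity whose slack is the first member `TI₂` of the TI hierarchy (memo §2).  Marked
multigraphs are the rank-2 layer in which the tree can state it today.
-/

namespace Summit.CriticalPhenomena.PercolationContinuityZ3.Theorems.SunflowerPartition.Kempe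

open Finset

namespace MGraph

variable {V : Type*} [Fintype V] [LinearOrder V] (K : MGraph V)

omit [Fintype V] in
/-- A mark added elsewhere keeps a free vertex free. [this work] -/
theorem isFree_addMark_of_ne {y : V} (hy : K.IsFree y) (p : V) (hpy : p ≠ y) (m : ℕ) : (K.addMark p m).IsFree y := by
  constructor
  · intro w
    unfold addMark addAtU
    simp [hy.mul_eq w]
  · unfold addMark addAtU
    simp [hy.mark_eq, hpy.symm]

/-- **`T(K/qp) = 3·Σ_{σ u = 0, σ v = 1, σ p = σ q} fC (type_K σ)`** for a non-terminal `q ≠ p`: the two-terminal functional of the contraction of `q` into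
`p` (on `V`, `q` free) is three times the part of the two-terminal sum of `K` on which `p` and `q` share a colour. [this work] -/
theorem TfunM_contractOne_eq (u v p q : V) (hpq : p ≠ q) (hqu : q ≠ u) (hqv : q ≠ v) :
    (K.contractOne q p).TfunM u v
      = 3 * ∑ σ ∈ univ.filter (fun σ : V → Fin 3 => (σ u = 0 ∧ σ v = 1) ∧ σ p = σ q), fC (K.ctypeM σ) := by
  have hfree := K.isFree_contractOne q p hpq.symm
  have h3 := sum_filter_eq_three_mul (V := V) q (fun σ : V → Fin 3 => σ u = 0 ∧ σ v = 1)
    (fun σ c => by rw [Function.update_of_ne hqu.symm, Function.update_of_ne hqv.symm])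
    (fun ρ => fC ((K.contractOne q p).ctypeM ρ)) (fun ρ c => by rw [(K.contractOne q p).ctypeM_update_of_isFree hfree ρ c])
    (fun ρ => ρ p) (fun ρ c => by rw [Function.update_of_ne hpq])
  unfold TfunM
  rw [h3]
  congr 1
  have hset : (univ.filter fun σ : V → Fin 3 => (σ u = 0 ∧ σ v = 1) ∧ σ q = σ p)
      = univ.filter (fun σ : V → Fin 3 => (σ u = 0 ∧ σ v = 1) ∧ σ p = σ q) := by
    ext σ
    simp only [mem_filter, mem_univ, true_and]
    exact ⟨fun h => ⟨h.1, h.2.symm⟩, fun h => ⟨h.1, h.2.symm⟩⟩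
  rw [hset]
  refine sum_congr rfl fun σ hσ => ?_
  rw [mem_filter] at hσ
  rw [K.ctypeM_contractOne_update q p hpq.symm σ, show Function.update σ q (σ p) = σ from by rw [hσ.2.2, Function.update_eq_self]]

/-- **`T((K/qp)⁺ᵖ) = 3·Σ_{σ u = 0, σ v = 1, σ p = σ q} fC (type_{K⁺ᵖ} σ)`**: the same for the contraction marked once at `p`. [this work] -/
theorem TfunM_addMark_contractOne (u v p q : V) (hpq : p ≠ q) (hqu : q ≠ u) (hqv : q ≠ v) :
    ((K.contractOne q p).addMark p 1).TfunM u v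
      = 3 * ∑ σ ∈ univ.filter (fun σ : V → Fin 3 => (σ u = 0 ∧ σ v = 1) ∧ σ p = σ q), fC ((K.addMark p 1).ctypeM σ) := by
  have hfree : ((K.contractOne q p).addMark p 1).IsFree q :=
    (K.contractOne q p).isFree_addMark_of_ne (K.isFree_contractOne q p hpq.symm) p hpq 1
  have h3 := sum_filter_eq_three_mul (V := V) q (fun σ : V → Fin 3 => σ u = 0 ∧ σ v = 1)
    (fun σ c => by rw [Function.update_of_ne hqu.symm, Function.update_of_ne hqv.symm])
    (fun ρ => fC (((K.contractOne q p).addMark p 1).ctypeM ρ)) (fun ρ c => by rw [((K.contractOne q p).addMark p 1).ctypeM_update_of_isFree hfree ρ c])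
    (fun ρ => ρ p) (fun ρ c => by rw [Function.update_of_ne hpq])
  unfold TfunM
  rw [h3]
  congr 1
  have hset : (univ.filter fun σ : V → Fin 3 => (σ u = 0 ∧ σ v = 1) ∧ σ q = σ p)
      = univ.filter (fun σ : V → Fin 3 => (σ u = 0 ∧ σ v = 1) ∧ σ p = σ q) := by
    ext σ
    simp only [mem_filter, mem_univ, true_and]
    exact ⟨fun h => ⟨h.1, h.2.symm⟩, fun h => ⟨h.1, h.2.symm⟩⟩
  rw [hset]
  refine sum_congr rfl fun σ hσ => ?_
  rw [mem_filter] at hσ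
  rw [K.ctypeM_contractOne_addMark p q hpq σ, K.ctypeM_addMark p 1 σ,
    show Function.update σ q (σ p) = σ from by rw [hσ.2.2, Function.update_eq_self]]

/-- **ADDING AN EDGE = THE MARK EFFECT ON THE CONTRACTION, for the two-terminal functional** ((MM_T) of the memo): for every marked multigraph `K`,
terminals `u, v`, and an edge `p–q` whose end `q` is not a terminal,
`3·[T(K + pq; u,v) − T(K; u,v)] = T((K/qp)⁺ᵖ; u,v) − T(K/qp; u,v)` (the contraction realised on `V` with `q` free, whence the factor `3`).
Both sides equal `3·Σ_{σ u = 0, σ v = 1, σ p = σ q} [fC (type ⊕ xPart (σ p) 𝟙) − fC type]. [this work] -/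
theorem three_mul_TfunM_addEdge_sub (u v p q : V) (hpq : p ≠ q) (hqu : q ≠ u) (hqv : q ≠ v) :
    3 * ((K.addAtU p (fun w => if w = q then 1 else 0) (if_neg hpq) 0).TfunM u v - K.TfunM u v)
      = ((K.contractOne q p).addMark p 1).TfunM u v - (K.contractOne q p).TfunM u v := by
  have hL : (K.addAtU p (fun w => if w = q then 1 else 0) (if_neg hpq) 0).TfunM u v - K.TfunM u v
      = ∑ σ ∈ univ.filter (fun σ : V → Fin 3 => (σ u = 0 ∧ σ v = 1) ∧ σ p = σ q),
          (fC ((K.addMark p 1).ctypeM σ) - fC (K.ctypeM σ)) := by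
    unfold TfunM
    rw [← sum_sub_distrib, ← sum_filter_add_sum_filter_not (univ.filter (fun σ : V → Fin 3 => σ u = 0 ∧ σ v = 1)) (fun σ : V → Fin 3 => σ p = σ q),
      filter_filter, filter_filter]
    have hz : ∑ σ ∈ univ.filter (fun σ : V → Fin 3 => (σ u = 0 ∧ σ v = 1) ∧ ¬ σ p = σ q),
        (fC ((K.addAtU p (fun w => if w = q then 1 else 0) (if_neg hpq) 0).ctypeM σ) - fC (K.ctypeM σ)) = 0 := by
      refine sum_eq_zero fun σ hσ => ?_
      rw [mem_filter] at hσ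
      have hqp : ¬ σ q = σ p := fun e => hσ.2.2 e.symm
      rw [K.ctypeM_addEdge p q hpq σ, if_neg hqp, ctAdd_xPart_zero, sub_self]
    rw [hz, add_zero]
    refine sum_congr rfl fun σ hσ => ?_
    rw [mem_filter] at hσ
    rw [K.ctypeM_addEdge p q hpq σ, if_pos hσ.2.2.symm, K.ctypeM_addMark p 1 σ]
  rw [hL, K.TfunM_addMark_contractOne u v p q hpq hqu hqv, K.TfunM_contractOne_eq u v p q hpq hqu hqv, ← mul_sub, ← sum_sub_distrib]

end MGraph

end Summit.CriticalPhenomena.PercolationContinuityZ3.Theorems.SunflowerPartition.Kempe
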